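import Summits.CriticalPhenomena.PercolationContinuityZ3.Theorems.PercNearOneGluingNoHeavyLowerTailSahiGridPatternZProfile
import Mathlib.Tactic.Linarith

/-!
# `NoHeavyLowerTail` (crux stmt-CriticalPhenomena-4575), lane prim-ineq-gen-4 (gen 17): the FIBRE LEMMAS of the
# spectator-by-spectator certificate for three-partition positivity with the threshold slot `Θ₂ = {x : 2 ≤ #x}`

Support file (`--supports stmt-CriticalPhenomena-4575`; memo `run/shared/lean/prim/prim-ineq-gen-4/FINDING-THRESHOLD-FIBREWISE-g17.md`,
proof text `PROOFS-THRESHOLD-TWO-g17.md`).  Pure finite combinatorics, no definitions, no `sorry`, standard axioms.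

THE CONTEXT.  The lane's three-partition functional `N(U,V,W)` (`ThreePartition.threePartN`) with a THRESHOLD first slot
`U = Θ_k = {x : k ≤ #x}` has the kernel form `N(Θ_k,V,W) = Σ_{u∈V∩W} μ_k(#u) − Σ_{(v,w)∈V×W disjoint} λ_k(#v,#w)` (memo §0(B)); distributing the
diagonal weights over the spectators `S ⊆ uᶜ` writes `N = Σ_S Φ_S`, each `Φ_S` a "weighted Kleitman" functional of the traces of
`W, V` on the cube `𝒫(Sᶜ)` (memo §0(E)).  For `k = 2` an explicit weight table makes every `Φ_S ≥ 0` (PROOFS-THRESHOLD-TWO-g17.md),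
so `N(Θ₂,V,W) ≥ 0` for all up-sets `V, W` in every dimension — the threshold slot `Θ₂` lies in none of the proved strata.  The
fibre inequalities needed are, on a cube `𝒫(Y)` (here: the finsets of a finite type `α`, `y = card α`, with `W ∩ Vᶜˢ =
{z ∈ W : zᶜ ∈ V}` the "cross pairs"):
* (GK)  graded Kleitman: `#{z ∈ W : zᶜ ∈ V, 2 ≤ #z} ≤ #{u ∈ W∩V : 2 ≤ #u}` and the mirror `#{z ∈ W : zᶜ ∈ V, 2 ≤ #zᶜ} ≤ #{u ∈ W∩V : 2 ≤ #u}`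
  (`card_filter_two_le_inter_compls_le`, `card_inter_compls_filter_two_le_le`; Kleitman-then-Harris `SahiGridPattern.card_inter_compls_le`
  applied to the up-sets `W ∩ Θ₂` resp. `V ∩ Θ₂`) — these two alone settle the fibres with `#S ≤ 1` up to the strictness unit below;
* (RAB₂) `card_window_add_singletons_le`: for up-sets `W, V` and `3 ≤ y`,
  `#{z ∈ W : zᶜ ∈ V, 2 ≤ #z ≤ y−2} + #{u ∈ W∩V : #u = 1} ≤ #{u ∈ W∩V : 2 ≤ #u}` — the fibres with `2 ≤ #S ≤ n−2`;
* (SK₂) `card_filter_two_le_inter_compls_lt`: strict Kleitman — if `W∩V` contains a singleton then the graded Kleitman inequality is strict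
  (the fibres with `#S = 1` carry weight `−1/(n−1)` per common singleton).
PROOFS (elementary): (RAB₂) — by (GK) the cross pairs of size `≥ 2` inject (non-constructively) into `W∩V∩Θ₂`; the cross pairs of size `y−1`
are the sets `{i}ᶜ` with `{i} ∈ V`, `{i}ᶜ ∈ W`, and every common singleton `{i}` yields one of them as soon as there are two common singletons
(then `{i}ᶜ ⊇ {j} ∈ W`) or `{p}ᶜ ∈ W`; in the remaining case `W = {z : p ∈ z}` exactly, and one counts directly (`z ↦ zᶜ ↦ insert p zᶜ`).
(SK₂) — the same pivot: split both families by `p ∈ z` and use inclusion–exclusion in `𝒫({p}ᶜ)`.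
HONEST LABEL: this file proves one-cube counting lemmas only; the assembly `N(Θ₂,V,W) = Σ_S Φ_S` in `threePartN` language is not formalised here.
-/

namespace Summit.CriticalPhenomena.PercolationContinuityZ3.Theorems.ThresholdTwoFibre

open Finset
open scoped FinsetFamily

variable {α : Type*} [DecidableEq α] [Fintype α]

omit [DecidableEq α] [Fintype α] in
/-- An up-set of finsets stays an up-set after restricting to the sets of size `≥ k` (`W ∩ Θ_k`). [folklore] -/
theorem isUpperSet_filter_card_le (W : Finset (Finset α)) (hW : IsUpperSet (W : Set (Finset α))) (k : ℕ) :
    IsUpperSet ((W.filter fun z => k ≤ #z : Finset (Finset α)) : Set (Finset α)) := by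
  intro a b hab ha
  rw [Finset.mem_coe, Finset.mem_filter] at ha ⊢
  exact ⟨hW hab ha.1, ha.2.trans (card_le_card hab)⟩

/-- **Graded Kleitman (first form).**  For up-sets `W, V`: `#{z ∈ W : zᶜ ∈ V, k ≤ #z} ≤ #{u ∈ W ∩ V : k ≤ #u}`
(Kleitman-then-Harris for the up-sets `W ∩ Θ_k` and `V`). [this work] -/
theorem card_filter_card_le_inter_compls_le (W V : Finset (Finset α)) (hW : IsUpperSet (W : Set (Finset α)))
    (hV : IsUpperSet (V : Set (Finset α))) (k : ℕ) :
    #((W.filter fun z => k ≤ #z) ∩ Vᶜˢ) ≤ #((W ∩ V).filter fun u => k ≤ #u) := by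
  have h := SahiGridPattern.card_inter_compls_le (isUpperSet_filter_card_le W hW k) hV
  rw [← filter_inter]
  exact h

/-- **Graded Kleitman (mirror form).**  For up-sets `W, V`: `#{z ∈ W : zᶜ ∈ V, k ≤ #zᶜ} ≤ #{u ∈ W ∩ V : k ≤ #u}`
(Kleitman-then-Harris for `W` and `V ∩ Θ_k`). [this work] -/
theorem card_inter_compls_filter_card_le_le (W V : Finset (Finset α)) (hW : IsUpperSet (W : Set (Finset α)))
    (hV : IsUpperSet (V : Set (Finset α))) (k : ℕ) :
    #(W ∩ (V.filter fun z => k ≤ #z)ᶜˢ) ≤ #((W ∩ V).filter fun u => k ≤ #u) := by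
  have h := SahiGridPattern.card_inter_compls_le hW (isUpperSet_filter_card_le V hV k)
  rw [← inter_filter]
  exact h

/-- Membership in the mirror family: `z ∈ W ∩ (V ∩ Θ_k)ᶜˢ ↔ z ∈ W ∧ zᶜ ∈ V ∧ k ≤ #zᶜ`. [this work] -/
theorem mem_inter_compls_filter_iff (W V : Finset (Finset α)) (k : ℕ) (z : Finset α) :
    z ∈ W ∩ (V.filter fun t => k ≤ #t)ᶜˢ ↔ z ∈ W ∧ zᶜ ∈ V ∧ k ≤ #zᶜ := by
  rw [mem_inter, mem_compls, mem_filter]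

/-- The two graded Kleitman inequalities together: the fibre inequality of the certificate on the fibres with spectator of
size `≤ 1` (weight `2` on every `u ∈ W∩V` with `2 ≤ #u`, cross pairs weighted `[2 ≤ #z] + [2 ≤ #zᶜ]`), without the
strictness unit. [this work] -/
theorem card_cross_two_le_two_mul (W V : Finset (Finset α)) (hW : IsUpperSet (W : Set (Finset α)))
    (hV : IsUpperSet (V : Set (Finset α))) :
    #((W.filter fun z => 2 ≤ #z) ∩ Vᶜˢ) + #(W ∩ (V.filter fun z => 2 ≤ #z)ᶜˢ)
      ≤ 2 * #((W ∩ V).filter fun u => 2 ≤ #u) := by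
  have h1 := card_filter_card_le_inter_compls_le W V hW hV 2
  have h2 := card_inter_compls_filter_card_le_le W V hW hV 2
  omega

/-- If `p ∉ z` then `z ⊆ {p}ᶜ`. [folklore] -/
theorem subset_compl_singleton_of_not_mem {p : α} {z : Finset α} (h : p ∉ z) : z ⊆ ({p} : Finset α)ᶜ := by
  intro x hx
  rw [mem_compl, mem_singleton]
  rintro rfl
  exact h hx

/-- In an up-set `W` with `{p}ᶜ ∉ W`, every member contains `p`. [folklore] -/
theorem mem_of_compl_singleton_not_mem {W : Finset (Finset α)} (hW : IsUpperSet (W : Set (Finset α))) {p : α}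
    (hp : ({p} : Finset α)ᶜ ∉ W) {z : Finset α} (hz : z ∈ W) : p ∈ z := by
  by_contra h
  exact hp (hW (subset_compl_singleton_of_not_mem h) hz)

/-- The common singletons of `W` and `V`, as a set of points, count the members of `W ∩ V` of size one. [this work] -/
theorem card_filter_card_eq_one_eq (W V : Finset (Finset α)) :
    #((W ∩ V).filter fun u => #u = 1) = #(univ.filter fun i : α => ({i} : Finset α) ∈ W ∧ ({i} : Finset α) ∈ V) := by
  rw [← card_image_of_injective (univ.filter fun i : α => ({i} : Finset α) ∈ W ∧ ({i} : Finset α) ∈ V)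
    (singleton_injective : Function.Injective fun i : α => ({i} : Finset α))]
  congr 1
  ext u
  simp only [mem_filter, mem_inter, mem_image, mem_univ, true_and, card_eq_one]
  constructor
  · rintro ⟨⟨huW, huV⟩, i, rfl⟩
    exact ⟨i, ⟨huW, huV⟩, rfl⟩
  · rintro ⟨i, ⟨hiW, hiV⟩, rfl⟩
    exact ⟨⟨hiW, hiV⟩, i, rfl⟩

/-- **(RAB₂)**, the fibre lemma of the natural weights.  For up-sets `W, V` of the finsets of a type with `3 ≤ card α =: y`:
`#{z ∈ W : zᶜ ∈ V, 2 ≤ #z ≤ y − 2} + #{u ∈ W ∩ V : #u = 1} ≤ #{u ∈ W ∩ V : 2 ≤ #u}`. [this work] -/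
theorem card_window_add_singletons_le (W V : Finset (Finset α)) (hW : IsUpperSet (W : Set (Finset α)))
    (hV : IsUpperSet (V : Set (Finset α))) (hα : 3 ≤ Fintype.card α) :
    #((W ∩ Vᶜˢ).filter fun z => 2 ≤ #z ∧ #z + 2 ≤ Fintype.card α) + #((W ∩ V).filter fun u => #u = 1)
      ≤ #((W ∩ V).filter fun u => 2 ≤ #u) := by
  rw [card_filter_card_eq_one_eq W V]
  set y := Fintype.card α with hy
  set X := (W ∩ Vᶜˢ).filter fun z => 2 ≤ #z ∧ #z + 2 ≤ y with hX
  set I := univ.filter fun i : α => ({i} : Finset α) ∈ W ∧ ({i} : Finset α) ∈ V with hI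
  set J := univ.filter fun i : α => ({i} : Finset α) ∈ V ∧ ({i} : Finset α)ᶜ ∈ W with hJ
  set P := (W ∩ V).filter fun u => 2 ≤ #u with hP
  -- graded Kleitman: the cross pairs of size ≥ 2 are at most #P
  have hGK : #((W.filter fun z => 2 ≤ #z) ∩ Vᶜˢ) ≤ #P := card_filter_card_le_inter_compls_le W V hW hV 2
  -- X and the sets {i}ᶜ, i ∈ J, are distinct cross pairs of size ≥ 2
  have hcardc : ∀ i : α, #(({i} : Finset α)ᶜ) = y - 1 := fun i => by rw [card_compl, card_singleton]
  have hXJ : #X + #J ≤ #((W.filter fun z => 2 ≤ #z) ∩ Vᶜˢ) := by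
    have hinj : Function.Injective fun i : α => ({i} : Finset α)ᶜ :=
      fun i j h => singleton_injective (compl_injective h)
    rw [← card_image_of_injective J hinj, ← card_union_of_disjoint]
    · refine card_le_card fun z hz => ?_
      rw [mem_union] at hz
      rw [mem_inter, mem_filter, mem_compls]
      rcases hz with hz | hz
      · rw [hX, mem_filter, mem_inter, mem_compls] at hz
        exact ⟨⟨hz.1.1, hz.2.1⟩, hz.1.2⟩
      · rw [mem_image] at hz
        obtain ⟨i, hi, rfl⟩ := hz
        rw [hJ, mem_filter] at hi
        refine ⟨⟨hi.2.2, ?_⟩, ?_⟩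
        · rw [hcardc]; omega
        · rw [compl_compl]; exact hi.2.1
    · rw [disjoint_left]
      intro z hz hz'
      rw [hX, mem_filter] at hz
      rw [mem_image] at hz'
      obtain ⟨i, -, rfl⟩ := hz'
      have := hcardc i
      omega
  -- it remains to compare the common singletons I with J (or to count directly)
  by_cases hI0 : #I = 0
  · rw [hI0]; omega
  by_cases hI2 : 2 ≤ #I
  · -- two common singletons: every {i}ᶜ (i ∈ I) contains another common singleton, hence lies in W
    have hIJ : I ⊆ J := by
      intro i hi
      have hi' := hi
      rw [hI, mem_filter] at hi'
      obtain ⟨j, hj, hji⟩ := exists_mem_ne (by omega : 1 < #I) i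
      rw [hI, mem_filter] at hj
      rw [hJ, mem_filter]
      have hsub : ({j} : Finset α) ⊆ ({i} : Finset α)ᶜ := by
        rw [singleton_subset_iff, mem_compl, mem_singleton]; exact hji
      exact ⟨mem_univ _, hi'.2.2, hW hsub hj.2.1⟩
    have := card_le_card hIJ
    omega
  · -- exactly one common singleton {p}
    have hI1 : #I = 1 := by omega
    obtain ⟨p, hIp⟩ := card_eq_one.1 hI1
    have hp : ({p} : Finset α) ∈ W ∧ ({p} : Finset α) ∈ V := by
      have : p ∈ I := by rw [hIp]; exact mem_singleton_self p
      rw [hI, mem_filter] at this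
      exact this.2
    rw [hIp, card_singleton]
    by_cases hpc : ({p} : Finset α)ᶜ ∈ W
    · -- then p ∈ J
      have hpJ : p ∈ J := by rw [hJ, mem_filter]; exact ⟨mem_univ _, hp.2, hpc⟩
      have : 1 ≤ #J := card_pos.2 ⟨p, hpJ⟩
      omega
    · -- every member of W contains p; count directly
      have hmem : ∀ z ∈ W, p ∈ z := fun z hz => mem_of_compl_singleton_not_mem hW hpc hz
      -- X ↪ T := {t : p ∉ t, t ∈ V, 2 ≤ #t} via z ↦ zᶜ, and insert p : T ↪ P misses {p, q}
      obtain ⟨q, -, hqp⟩ := exists_mem_ne (by rw [card_univ]; omega : 1 < #(univ : Finset α)) p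
      set T := univ.filter fun t : Finset α => p ∉ t ∧ t ∈ V ∧ 2 ≤ #t with hT
      have hXT : #X ≤ #T := by
        rw [← card_image_of_injective X (compl_injective : Function.Injective (compl : Finset α → Finset α))]
        refine card_le_card fun t ht => ?_
        rw [mem_image] at ht
        obtain ⟨z, hz, rfl⟩ := ht
        rw [hX, mem_filter, mem_inter, mem_compls] at hz
        rw [hT, mem_filter]
        refine ⟨mem_univ _, fun h => ?_, hz.1.2, ?_⟩
        · rw [mem_compl] at h; exact h (hmem z hz.1.1)
        · rw [card_compl]; omega
      have hTP : #T + 1 ≤ #P := by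
        have hinj : Set.InjOn (fun t : Finset α => insert p t) ↑T := by
          intro t ht t' ht' h
          rw [mem_coe, hT, mem_filter] at ht ht'
          simp only at h
          rw [← erase_insert ht.2.1, h, erase_insert ht'.2.1]
        have hpq : ({p, q} : Finset α) ∈ P := by
          rw [hP, mem_filter, mem_inter, card_pair hqp.symm]
          have hsub : ({p} : Finset α) ⊆ {p, q} := by
            rw [singleton_subset_iff, mem_insert]; exact Or.inl rfl
          exact ⟨⟨hW hsub hp.1, hV hsub hp.2⟩, le_rfl⟩
        have hnot : ({p, q} : Finset α) ∉ T.image fun t => insert p t := by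
          rw [mem_image]
          rintro ⟨t, ht, h⟩
          rw [hT, mem_filter] at ht
          have hct : #(insert p t) = #t + 1 := card_insert_of_notMem ht.2.1
          rw [h, card_pair hqp.symm] at hct
          omega
        have hsubP : insert ({p, q} : Finset α) (T.image fun t => insert p t) ⊆ P := by
          intro u hu
          rw [mem_insert] at hu
          rcases hu with rfl | hu
          · exact hpq
          · rw [mem_image] at hu
            obtain ⟨t, ht, rfl⟩ := hu
            rw [hT, mem_filter] at ht
            rw [hP, mem_filter, mem_inter]
            have hsub : ({p} : Finset α) ⊆ insert p t := by
              rw [singleton_subset_iff]; exact mem_insert_self p t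
            refine ⟨⟨hW hsub hp.1, hV hsub hp.2⟩, ?_⟩
            rw [card_insert_of_notMem ht.2.1]; omega
        have h1 := card_le_card hsubP
        rw [card_insert_of_notMem hnot, card_image_of_injOn hinj] at h1
        omega
      omega

/-- **(SK₂) strict Kleitman.**  If the up-sets `W, V` (`∅ ∉ V`, `3 ≤ card α`) have a common singleton `{p}`, the graded Kleitman
inequality is strict: `#{z ∈ W : zᶜ ∈ V, 2 ≤ #z} < #{u ∈ W ∩ V : 2 ≤ #u}`.  Proof: the map `z ↦ insert p z` (`p ∉ z`),
`z ↦ zᶜ` (`p ∈ z`, `zᶜ ∈ W`, `2 ≤ #zᶜ`), `z ↦ insert p zᶜ` (otherwise) is injective from the left family into the right one and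
misses `univ`, `{p}ᶜ` or a pair `{p, q}` according as `{p}ᶜ ∉ W`, `{p}ᶜ ∈ W ∩ V`, or `{p}ᶜ ∈ W ∖ V`. [this work] -/
theorem card_filter_two_le_inter_compls_lt (W V : Finset (Finset α)) (hW : IsUpperSet (W : Set (Finset α)))
    (hV : IsUpperSet (V : Set (Finset α))) (hV0 : ∅ ∉ V) (hα : 3 ≤ Fintype.card α) {p : α}
    (hpW : ({p} : Finset α) ∈ W) (hpV : ({p} : Finset α) ∈ V) :
    #((W.filter fun z => 2 ≤ #z) ∩ Vᶜˢ) < #((W ∩ V).filter fun u => 2 ≤ #u) := by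
  set y := Fintype.card α with hy
  set B := (W.filter fun z => 2 ≤ #z) ∩ Vᶜˢ with hB
  set A := (W ∩ V).filter fun u => 2 ≤ #u with hA
  have hsupW : ∀ z : Finset α, p ∈ z → z ∈ W := fun z hz => hW (singleton_subset_iff.2 hz) hpW
  have hsupV : ∀ z : Finset α, p ∈ z → z ∈ V := fun z hz => hV (singleton_subset_iff.2 hz) hpV
  have hmemB : ∀ z, z ∈ B ↔ (z ∈ W ∧ 2 ≤ #z) ∧ zᶜ ∈ V := fun z => by
    rw [hB, mem_inter, mem_filter, mem_compls]
  have hmemA : ∀ u, u ∈ A ↔ (u ∈ W ∧ u ∈ V) ∧ 2 ≤ #u := fun u => by rw [hA, mem_filter, mem_inter]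
  have hpc : ∀ z : Finset α, p ∈ z → p ∉ zᶜ := fun z hz h => (mem_compl.1 h) hz
  have hne : ∀ t : Finset α, t ∈ V → 1 ≤ #t := fun t ht => by
    rw [Nat.one_le_iff_ne_zero, Ne, card_eq_zero]; rintro rfl; exact hV0 ht
  have hcardc : #(({p} : Finset α)ᶜ) = y - 1 := by rw [card_compl, card_singleton]
  -- the map
  let φ : Finset α → Finset α := fun z =>
    if p ∈ z then (if zᶜ ∈ W ∧ 2 ≤ #zᶜ then zᶜ else insert p zᶜ) else insert p z
  have hφ1 : ∀ z, p ∉ z → φ z = insert p z := fun z hz => by simp only [φ, hz, if_false]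
  have hφ2 : ∀ z, p ∈ z → (zᶜ ∈ W ∧ 2 ≤ #zᶜ) → φ z = zᶜ := fun z hz hc => by simp only [φ, hz, hc, and_self, if_true]
  have hφ3 : ∀ z, p ∈ z → ¬ (zᶜ ∈ W ∧ 2 ≤ #zᶜ) → φ z = insert p zᶜ := fun z hz hc => by
    simp only [φ, hz, if_true, if_neg hc]
  -- image lies in A
  have himage : ∀ z ∈ B, φ z ∈ A := by
    intro z hz
    rw [hmemB] at hz
    obtain ⟨⟨hzW, hz2⟩, hzV⟩ := hz
    rw [hmemA]
    by_cases hpz : p ∈ z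
    · by_cases hcW : zᶜ ∈ W ∧ 2 ≤ #zᶜ
      · rw [hφ2 z hpz hcW]; exact ⟨⟨hcW.1, hzV⟩, hcW.2⟩
      · rw [hφ3 z hpz hcW]
        refine ⟨⟨hsupW _ (mem_insert_self _ _), hV (subset_insert p zᶜ) hzV⟩, ?_⟩
        have h1 := hne _ hzV
        rw [card_insert_of_notMem (hpc z hpz)]; omega
    · rw [hφ1 z hpz]
      refine ⟨⟨hsupW _ (mem_insert_self _ _), hsupV _ (mem_insert_self _ _)⟩, ?_⟩
      rw [card_insert_of_notMem hpz]; omega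
  -- injectivity
  have hinj : Set.InjOn φ ↑B := by
    intro z hz z' hz' h
    rw [mem_coe, hmemB] at hz hz'
    by_cases hpz : p ∈ z <;> by_cases hpz' : p ∈ z'
    · by_cases hc : zᶜ ∈ W ∧ 2 ≤ #zᶜ <;> by_cases hc' : z'ᶜ ∈ W ∧ 2 ≤ #z'ᶜ
      · rw [hφ2 z hpz hc, hφ2 z' hpz' hc'] at h; exact compl_injective h
      · rw [hφ2 z hpz hc, hφ3 z' hpz' hc'] at h
        exact absurd (h ▸ mem_insert_self p z'ᶜ : p ∈ zᶜ) (hpc z hpz)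
      · rw [hφ3 z hpz hc, hφ2 z' hpz' hc'] at h
        exact absurd (h.symm ▸ mem_insert_self p zᶜ : p ∈ z'ᶜ) (hpc z' hpz')
      · rw [hφ3 z hpz hc, hφ3 z' hpz' hc'] at h
        have : zᶜ = z'ᶜ := by rw [← erase_insert (hpc z hpz), h, erase_insert (hpc z' hpz')]
        exact compl_injective this
    · rw [hφ1 z' hpz'] at h
      by_cases hc : zᶜ ∈ W ∧ 2 ≤ #zᶜ
      · rw [hφ2 z hpz hc] at h
        exact absurd (h.symm ▸ mem_insert_self p z' : p ∈ zᶜ) (hpc z hpz)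
      · rw [hφ3 z hpz hc] at h
        have hzc : zᶜ = z' := by rw [← erase_insert (hpc z hpz), h, erase_insert hpz']
        exact absurd ⟨hzc ▸ hz'.1.1, hzc ▸ hz'.1.2⟩ hc
    · rw [hφ1 z hpz] at h
      by_cases hc' : z'ᶜ ∈ W ∧ 2 ≤ #z'ᶜ
      · rw [hφ2 z' hpz' hc'] at h
        exact absurd (h ▸ mem_insert_self p z : p ∈ z'ᶜ) (hpc z' hpz')
      · rw [hφ3 z' hpz' hc'] at h
        have hzc : z = z'ᶜ := by rw [← erase_insert hpz, h, erase_insert (hpc z' hpz')]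
        exact absurd ⟨hzc ▸ hz.1.1, hzc ▸ hz.1.2⟩ hc'
    · rw [hφ1 z hpz, hφ1 z' hpz'] at h
      rw [← erase_insert hpz, h, erase_insert hpz']
  -- a missed element of A
  have hwit : ∃ w ∈ A, w ∉ B.image φ := by
    by_cases hcpW : ({p} : Finset α)ᶜ ∈ W
    · by_cases hcpV : ({p} : Finset α)ᶜ ∈ V
      · refine ⟨({p} : Finset α)ᶜ, (hmemA _).2 ⟨⟨hcpW, hcpV⟩, by rw [hcardc]; omega⟩, ?_⟩
        rw [mem_image]; rintro ⟨z, hz, hzw⟩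
        rw [hmemB] at hz
        have hpn : p ∉ ({p} : Finset α)ᶜ := fun h => (mem_compl.1 h) (mem_singleton_self p)
        by_cases hpz : p ∈ z
        · by_cases hc : zᶜ ∈ W ∧ 2 ≤ #zᶜ
          · rw [hφ2 z hpz hc] at hzw
            have : z = {p} := compl_injective hzw
            rw [this, card_singleton] at hz; omega
          · rw [hφ3 z hpz hc] at hzw; exact hpn (hzw ▸ mem_insert_self p zᶜ)
        · rw [hφ1 z hpz] at hzw; exact hpn (hzw ▸ mem_insert_self p z)
      · -- no member of V avoids p, so every z ∈ B has p ∉ z; witness {p, q}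
        obtain ⟨q, -, hqp⟩ := exists_mem_ne (by rw [card_univ]; omega : 1 < #(univ : Finset α)) p
        refine ⟨{p, q}, (hmemA _).2 ⟨⟨hsupW _ (mem_insert_self _ _), hsupV _ (mem_insert_self _ _)⟩,
          by rw [card_pair hqp.symm]⟩, ?_⟩
        rw [mem_image]; rintro ⟨z, hz, hzw⟩
        rw [hmemB] at hz
        by_cases hpz : p ∈ z
        · exact hcpV (hV (subset_compl_singleton_of_not_mem (hpc z hpz)) hz.2)
        · rw [hφ1 z hpz] at hzw
          have hzq : z = {q} := by
            rw [← erase_insert hpz, hzw, erase_insert]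
            rw [mem_singleton]; exact hqp.symm
          rw [hzq, card_singleton] at hz; omega
    · refine ⟨univ, (hmemA _).2 ⟨⟨hsupW _ (mem_univ p), hsupV _ (mem_univ p)⟩, by rw [card_univ]; omega⟩, ?_⟩
      rw [mem_image]; rintro ⟨z, hz, hzw⟩
      rw [hmemB] at hz
      by_cases hpz : p ∈ z
      · by_cases hc : zᶜ ∈ W ∧ 2 ≤ #zᶜ
        · rw [hφ2 z hpz hc] at hzw
          have : z = ∅ := by rw [← compl_compl z, hzw, compl_univ]
          rw [this, card_empty] at hz; omega
        · rw [hφ3 z hpz hc] at hzw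
          have hzc : zᶜ = ({p} : Finset α)ᶜ := by
            rw [← erase_insert (hpc z hpz), hzw, ← compl_singleton]
          have : z = {p} := compl_injective hzc
          rw [this, card_singleton] at hz; omega
      · rw [hφ1 z hpz] at hzw
        have hzc : z = ({p} : Finset α)ᶜ := by rw [← erase_insert hpz, hzw, ← compl_singleton]
        exact hcpW (hzc ▸ hz.1.1)
  obtain ⟨w, hwA, hwn⟩ := hwit
  have hsub : B.image φ ⊆ A.erase w := by
    intro u hu
    rw [mem_erase]
    refine ⟨fun h => hwn (h ▸ hu), ?_⟩
    rw [mem_image] at hu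
    obtain ⟨z, hz, rfl⟩ := hu
    exact himage z hz
  have h1 := card_le_card hsub
  rw [card_image_of_injOn hinj, card_erase_of_mem hwA] at h1
  have h2 : 0 < #A := card_pos.2 ⟨w, hwA⟩
  omega

end Summit.CriticalPhenomena.PercolationContinuityZ3.Theorems.ThresholdTwoFibre
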